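import Literature.Topology.FourManifolds.LefschetzHandlebody
import Literature.Topology.FourManifolds.CorkDecomposition
import Literature.Topology.FourManifolds.CollarAttachment
import Summits.SmoothPoincare4.SmoothPoincare4.Theorems.ConvexBisectionAcyclicBisectionExistsMultiAttachmentSplitLink
import Summits.SmoothPoincare4.SmoothPoincare4.Theorems.ConvexBisectionAcyclicBisectionExistsStubModelsOnCounts
import Summits.SmoothPoincare4.SmoothPoincare4.Theorems.ConvexBisectionAcyclicBisectionExistsSplitComplementLevel
import HarnessLib

/-!
# The complement piece, III: `M = X₁ ∪_φ W₂` — the positive sub-handlebody of a sorted fibred model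
# and its complement, glued along a regular level
(helper file 3/3 of the wave-2 brick T2 "the complement piece `W₂`" for stub
`stub_steinRealisation` (NF6), line `modp-braid-orbits` r11, crux
`ConvexBisection.AcyclicBisectionExists`, item stmt-SmoothPoincare4-10508; lead c4)

Baykur (2006), proof of Thm. 5.1: a sorted fibred model `M = X(F; P ++ N) ∪_Ψ Base g` is
`W₁ ∪ W₂` with `W₁ = X₊ = X(F; P)` the positive Lefschetz sub-handlebody and `W₂` "the rest".  Here
the TOPOLOGICAL half of this sentence is proved in the tree's vocabulary: with
`X₁ = Base g ∪ (positive handles)` and `X = X₁ ∪ (negative handles)` from the landed splitting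
`helper_isMultiAttachment_split_append` (…MultiAttachmentSplitLink.lean), and the regular level
`c` of the pushed-forward collar height `G = pushB` of file 2/3 (`isRegularLevel_pushB`,
`le_pushB_iff`):

* `supDiffeo` — **`X₁ ≅ {c ≤ G}`**, the diffeomorphism `x ↦ jX (jA (shrink x))` onto the regular
  superlevel set (`RegularSuperlevel`, `RegularLevelSplitting.lean`): smooth into the regular
  domain by `HalfSliceAtlas.contMDiff_codRestrict` (Lee 2013, Cor. 5.30); the inverse is smooth
  because its composites with the immersions `jA ∘ shrink` and then `jX` are
  (`ContMDiffAt.iff_comp_isImmersionAt`), the last one being the inclusion `{c ≤ G} → M`;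
* `isBoundaryGluing_superlevel` — **`M = X₁ ∪_φ W₂`** with `W₂ = {G ≤ c}` (`RegularSublevel`), by
  Milnor's splitting `M = {G ≤ c} ∪ {G ≥ c}` (`RegularSublevel.isBoundaryGluing_split`, Milnor 1963
  Thm. 3.1) transported along `supDiffeo` (`IsBoundaryGluing.transfer`, Hirsch 1976 §8.2);
* `exists_complement_of_isMultiAttachment` — abstract form: `X = X₁ ∪ (handles)` (Kosinski
  multi-attachment) and `M = X ∪_Ψ W` give `M = X₁ ∪_φ W₂` for a compact `W₂`;
* `helper_exists_complement_of_split` (registered) — for `hM : ModelsOnFibred M g (P ++ N)`: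
  the Lefschetz link `h`, Baykur's `X₊ = X₁` with its multi-attachment data `D₁` of the prefix
  sub-link, a compact `W₂`, boundary data and `φ` with `IsBoundaryGluing b₁ b₂ φ (𝓡 4) M`.

What T2 does NOT give (recorded in the stub report): `W₂` as the cap `Base g` with the DUAL
negative handles (Baykur's `−X₋` as a Lefschetz handlebody, brick T3), and the Stein/contact half.
Everything here is proved; no named facts.

## References
* R. İ. Baykur, *Kähler decomposition of 4-manifolds*, AGT 6 (2006), proof of Thm. 5.1. [Baykur2006]
* J. Milnor, *Morse theory* (1963), Thm. 3.1. [Milnor1963]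
* M. W. Hirsch, *Differential Topology* (1976), §8.2. [HirschDT1976]
* J. M. Lee, *Introduction to Smooth Manifolds* (2013), Prop. 5.49, Cor. 5.30. [LeeSmoothManifolds2013]
* A. A. Kosinski, *Differential Manifolds* (1993), VI §5, §6. [Kosinski1993]
-/

noncomputable section

-- the prescribed namespace `Summit.<P>.<Sub>.…` duplicates `SmoothPoincare4` (P = Sub)
set_option linter.dupNamespace false

open scoped Manifold ContDiff Topology

namespace Summit.SmoothPoincare4.SmoothPoincare4.Theorems.AcyclicBisectionExists.ModpBraidOrbits

open Set Function Filter
open Literature.Topology.FourManifolds Literature.Topology.FourManifolds.HandleAttachingMap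
  Literature.Topology.FourManifolds.LefschetzBase CollarShrink BoundaryData.OpenCollar

/-! ### §1 `X₁ ≅ {c ≤ G}` and `M = X₁ ∪_φ {G ≤ c}` -/

section Superlevel

variable {X₁ : Type} [TopologicalSpace X₁] [T2Space X₁] [CompactSpace X₁]
  [ChartedSpace (EuclideanHalfSpace 4) X₁] [IsManifold (𝓡∂ 4) ∞ X₁]
  {b : BoundaryData (𝓡∂ 4) X₁ (𝓡 3)} (D : b.OpenCollar)
  {C : TopologicalSpace.Opens X₁} (hC : ∀ x, (𝓡∂ 4).IsInteriorPoint x → x ∈ C)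

include hC in
/-- The shrink map lands in the interior, hence in `C`. [cite: Kosinski1993, VI §5] -/
theorem shrink_mem_opens (x : X₁) : D.shrink univ x ∈ C := by
  haveI : CompactSpace b.carrier := b.compactSpace_carrier
  refine hC _ (((𝓡∂ 4).isInteriorPoint_iff_not_isBoundaryPoint _).2 fun hb => ?_)
  have h1 := D.shrink_mem_away univ isCompact_univ x
  rw [b.mem_away_iff univ isCompact_univ, image_univ, b.range_incl] at h1
  exact h1 hb

/-- The shrink map as a map into `C`. [folklore] -/
def shrinkC (x : X₁) : C := ⟨D.shrink univ x, shrink_mem_opens D hC x⟩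

variable {X : Type} [TopologicalSpace X] [T2Space X] [ChartedSpace (EuclideanHalfSpace 4) X]
  [IsManifold (𝓡∂ 4) ∞ X] (jA : C → X)

/-- **The pushed-in embedding `X₁ → X`, `x ↦ jA (shrink x)`.** [cite: Kosinski1993, VI §5–6] -/
def emb (x : X₁) : X := jA (shrinkC D hC x)

variable {jA}

omit [T2Space X] [IsManifold (𝓡∂ 4) ∞ X] in
/-- The pushed-in embedding is injective. [folklore] -/
theorem injective_emb (hjA : Manifold.IsSmoothEmbedding (𝓡∂ 4) (𝓡∂ 4) ∞ jA) :
    Injective (emb D hC jA) := fun _ _ h =>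
  D.shrink_injective univ (congrArg Subtype.val (hjA.isEmbedding.injective h))

omit [T2Space X] [IsManifold (𝓡∂ 4) ∞ X] in
/-- The pushed-in embedding is smooth. [folklore] -/
theorem contMDiff_emb (hjA : Manifold.IsSmoothEmbedding (𝓡∂ 4) (𝓡∂ 4) ∞ jA) :
    ContMDiff (𝓡∂ 4) (𝓡∂ 4) ∞ (emb D hC jA) := by
  haveI : CompactSpace b.carrier := b.compactSpace_carrier
  refine hjA.contMDiff.comp ?_
  rw [← ContMDiff.subtypeVal_comp_iff]
  exact D.contMDiff_shrink univ isOpen_univ isCompact_univ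

omit [T2Space X] [IsManifold (𝓡∂ 4) ∞ X] in
/-- The pushed-in embedding is continuous. [folklore] -/
theorem continuous_emb (hjA : Manifold.IsSmoothEmbedding (𝓡∂ 4) (𝓡∂ 4) ∞ jA) :
    Continuous (emb D hC jA) :=
  (contMDiff_emb D hC hjA).continuous

omit [T2Space X] in
/-- The pushed-in embedding is an immersion at every point (the shrink map is,
`CobordismAttachment.isImmersionAtOfComplement_jWref`; corestrict to the open `C` and postcompose
with the open embedding `jA`). [folklore] -/
theorem isImmersionAt_emb (hjA : Manifold.IsSmoothEmbedding (𝓡∂ 4) (𝓡∂ 4) ∞ jA)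
    (hjAo : IsOpen (range jA)) (x : X₁) :
    Manifold.IsImmersionAt (𝓡∂ 4) (𝓡∂ 4) ∞ (emb D hC jA) x :=
  (((CobordismAttachment.isImmersionAtOfComplement_jWref D x).codRestrict_opens C
    (shrink_mem_opens D hC)).openEmbedding_comp hjA hjAo).isImmersionAt

variable {M : Type} [TopologicalSpace M] [T2Space M] [ChartedSpace (EuclideanSpace ℝ (Fin 4)) M]
  [IsManifold (𝓡 4) ∞ M] {jX : X → M}
  (hjA : Manifold.IsSmoothEmbedding (𝓡∂ 4) (𝓡∂ 4) ∞ jA) (hjAo : IsOpen (range jA))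
  (hjX : Manifold.IsSmoothEmbedding (𝓡∂ 4) (𝓡 4) ∞ jX)

omit [T2Space X] [T2Space M] [IsManifold (𝓡 4) ∞ M] in
include hjA hjAo hjX in
/-- The pushed-in copy lies in the superlevel set `{c ≤ pushB}`. [folklore] -/
theorem sub_pushB_emb_nonpos (x : X₁) :
    (fun y => shrinkConst - pushB D C jA jX y) (jX (emb D hC jA x)) ≤ 0 := by
  show shrinkConst - pushB D C jA jX (jX (emb D hC jA x)) ≤ 0
  rw [sub_nonpos, le_pushB_iff D hjA hjAo hjX.isEmbedding.injective]
  exact ⟨shrinkC D hC x, rfl, (le_collarHeightFn_iff_mem_range_shrink D _).2 ⟨x, rfl⟩⟩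

omit [T2Space X] [T2Space M] [IsManifold (𝓡 4) ∞ M] in
include hjA hjAo hjX in
/-- Points of the superlevel set `{c ≤ pushB}` are pushed-in points. [folklore] -/
theorem exists_emb_eq_of_le_pushB {p : M} (hp : shrinkConst ≤ pushB D C jA jX p) :
    ∃ x, jX (emb D hC jA x) = p := by
  obtain ⟨a, rfl, ha⟩ := (le_pushB_iff D hjA hjAo hjX.isEmbedding.injective p).1 hp
  obtain ⟨x, hx⟩ := (le_collarHeightFn_iff_mem_range_shrink D _).1 ha
  refine ⟨x, ?_⟩
  show jX (jA (shrinkC D hC x)) = jX (jA a)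
  rw [show shrinkC D hC x = a from Subtype.ext hx]

/-- **The pushed-in embedding as a map onto the regular superlevel set `{c ≤ pushB}`.**
[cite: Milnor1963, Thm. 3.1] -/
def toSup (x : X₁) : RegularSuperlevel (isRegularLevel_pushB D hC hjA hjAo hjX) :=
  RegularSublevel.mk _ (jX (emb D hC jA x)) (sub_pushB_emb_nonpos D hC hjA hjAo hjX x)

/-- `incl (toSup x) = jX (emb x)` (definitional). [folklore] -/
@[simp] theorem incl_toSup (x : X₁) :
    RegularSublevel.incl _ (toSup D hC hjA hjAo hjX x) = jX (emb D hC jA x) := rfl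

/-- `toSup` is smooth (smooth maps into a regular domain, `HalfSliceAtlas.contMDiff_codRestrict`).
[cite: LeeSmoothManifolds2013, Cor. 5.30] -/
theorem contMDiff_toSup : ContMDiff (𝓡∂ 4) (𝓡∂ 4) ∞ (toSup D hC hjA hjAo hjX) :=
  (RegularSublevel.halfSliceAtlas (isRegularLevel_pushB D hC hjA hjAo hjX).const_sub).contMDiff_codRestrict
    (fun x => sub_pushB_emb_nonpos D hC hjA hjAo hjX x) (hjX.contMDiff.comp (contMDiff_emb D hC hjA))

/-- `toSup` is bijective. [folklore] -/
theorem bijective_toSup : Bijective (toSup D hC hjA hjAo hjX) := by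
  constructor
  · intro x y h
    exact injective_emb D hC hjA (hjX.isEmbedding.injective (congrArg (RegularSublevel.incl _) h))
  · intro s
    have hs : shrinkConst ≤ pushB D C jA jX (RegularSublevel.incl _ s) :=
      (level_le_iff_const_sub_nonpos _).2 (RegularSublevel.apply_incl_le _ s)
    obtain ⟨x, hx⟩ := exists_emb_eq_of_le_pushB D hC hjA hjAo hjX hs
    exact ⟨x, RegularSublevel.injective_incl _ (by rw [incl_toSup, hx])⟩

/-- `toSup` as a bijection. [folklore] -/
def toSupEquiv : X₁ ≃ RegularSuperlevel (isRegularLevel_pushB D hC hjA hjAo hjX) :=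
  Equiv.ofBijective _ (bijective_toSup D hC hjA hjAo hjX)

/-- `toSup` as a homeomorphism (a continuous bijection from a compact space to a Hausdorff space).
[folklore] -/
def toSupHomeo : X₁ ≃ₜ RegularSuperlevel (isRegularLevel_pushB D hC hjA hjAo hjX) :=
  (contMDiff_toSup D hC hjA hjAo hjX).continuous.homeoOfEquivCompactToT2
    (f := toSupEquiv D hC hjA hjAo hjX)

/-- `jX (emb (toSup⁻¹ s)) = incl s`. [folklore] -/
theorem jX_emb_symm_apply (s : RegularSuperlevel (isRegularLevel_pushB D hC hjA hjAo hjX)) :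
    jX (emb D hC jA ((toSupEquiv D hC hjA hjAo hjX).symm s)) = RegularSublevel.incl _ s := by
  rw [← incl_toSup D hC hjA hjAo hjX]
  exact congrArg (RegularSublevel.incl _) ((toSupEquiv D hC hjA hjAo hjX).apply_symm_apply s)

/-- **The inverse of `toSup` is smooth**: its composite with the immersion `emb` followed by the
immersion `jX` is the smooth inclusion `{c ≤ pushB} → M` (`ContMDiffAt.iff_comp_isImmersionAt`,
twice). [cite: LeeSmoothManifolds2013, Prop. 5.49] -/
theorem contMDiff_toSup_symm :
    ContMDiff (𝓡∂ 4) (𝓡∂ 4) ∞ (toSupEquiv D hC hjA hjAo hjX).symm := by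
  intro s
  have hcont : Continuous (toSupEquiv D hC hjA hjAo hjX).symm :=
    (toSupHomeo D hC hjA hjAo hjX).symm.continuous
  rw [ContMDiffAt.iff_comp_isImmersionAt (isImmersionAt_emb D hC hjA hjAo _)]
  refine ⟨hcont.continuousAt, ?_⟩
  rw [ContMDiffAt.iff_comp_isImmersionAt (hjX.isImmersion.isImmersionAt _)]
  refine ⟨((continuous_emb D hC hjA).comp hcont).continuousAt, ?_⟩
  have heq : (jX ∘ (emb D hC jA ∘ (toSupEquiv D hC hjA hjAo hjX).symm)) = RegularSublevel.incl _ :=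
    funext fun s' => jX_emb_symm_apply D hC hjA hjAo hjX s'
  rw [heq]
  exact RegularSublevel.contMDiff_incl _ s

/-- **`X₁ ≅ {c ≤ pushB}`**: the pushed-in embedding is a diffeomorphism of `X₁` onto the regular
superlevel set. [cite: Milnor1963, Thm. 3.1] -/
def supDiffeo : X₁ ≃ₘ⟮𝓡∂ 4, 𝓡∂ 4⟯ RegularSuperlevel (isRegularLevel_pushB D hC hjA hjAo hjX) where
  toEquiv := toSupEquiv D hC hjA hjAo hjX
  contMDiff_toFun := contMDiff_toSup D hC hjA hjAo hjX
  contMDiff_invFun := contMDiff_toSup_symm D hC hjA hjAo hjX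

/-- `supDiffeo` on points of `M`. [folklore] -/
@[simp] theorem incl_supDiffeo (x : X₁) :
    RegularSublevel.incl _ (supDiffeo D hC hjA hjAo hjX x) = jX (emb D hC jA x) := rfl

/-- **`M = X₁ ∪_φ W₂` with `W₂ = {pushB ≤ c}`**: Milnor's splitting of `M` along the regular level
`c` (`RegularSublevel.isBoundaryGluing_split`), read as `{c ≤ pushB} ∪ {pushB ≤ c}` and transported
along `supDiffeo : X₁ ≅ {c ≤ pushB}` (`IsBoundaryGluing.transfer`); the gluing map is
`∂(supDiffeo)` followed by the identification of the two copies of the level.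
[cite: Milnor1963, Thm. 3.1] -/
theorem isBoundaryGluing_superlevel :
    IsBoundaryGluing b (RegularSublevel.boundaryData (isRegularLevel_pushB D hC hjA hjAo hjX))
      ((b.restrictDiffeomorph
          (RegularSublevel.boundaryData (isRegularLevel_pushB D hC hjA hjAo hjX).const_sub)
          (supDiffeo D hC hjA hjAo hjX)).trans
        (RegularSublevel.splitDiffeomorph (isRegularLevel_pushB D hC hjA hjAo hjX)).symm) (𝓡 4) M := by
  have h := (RegularSublevel.isBoundaryGluing_split (isRegularLevel_pushB D hC hjA hjAo hjX)).symm'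
  exact h.transfer (supDiffeo D hC hjA hjAo hjX)

end Superlevel

/-! ### §2 The complement piece of a multi-attachment inside a closed gluing -/

section Application

/-- **The complement piece, abstract form.**  Let `X = X₁ ∪_{q} (handles)` be a Kosinski
multi-attachment over a compact `X₁` with `∂X₁ ≠ ∅` and `M = X ∪_Ψ W` a closed gluing (compact `M`
without boundary).  Then `M = X₁ ∪_φ W₂` for a compact `4`-manifold with boundary `W₂` (the regular
sublevel set `{pushB ≤ c}`), the boundary datum `∂X₁` of `X₁`, and a diffeomorphism
`φ : ∂X₁ ≅ ∂W₂`.  Baykur (2006), proof of Thm. 5.1 (`M = X₊ ∪ (the rest)`); Milnor (1963),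
Thm. 3.1. [cite: Baykur2006, Thm. 5.1 (proof)] -/
theorem exists_complement_of_isMultiAttachment {X₁ : Type} [TopologicalSpace X₁] [T2Space X₁]
    [CompactSpace X₁] [ChartedSpace (EuclideanHalfSpace 4) X₁] [IsManifold (𝓡∂ 4) ∞ X₁]
    (hne : ((𝓡∂ 4).boundary X₁).Nonempty)
    {ι : Type} [Finite ι] {q : ι → HandleAttachingMap 3 2 X₁}
    {X : Type} [TopologicalSpace X] [T2Space X] [ChartedSpace (EuclideanHalfSpace 4) X]
    [IsManifold (𝓡∂ 4) ∞ X] (hX : HandleAttachingMap.IsMultiAttachment q (𝓡∂ 4) X)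
    {W : Type} [TopologicalSpace W] [ChartedSpace (EuclideanHalfSpace 4) W]
    (bX : BoundaryData (𝓡∂ 4) X (𝓡 3)) (bW : BoundaryData (𝓡∂ 4) W (𝓡 3))
    (Ψ : bX.carrier → bW.carrier)
    {M : Type} [TopologicalSpace M] [T2Space M] [SecondCountableTopology M] [CompactSpace M]
    [ChartedSpace (EuclideanSpace ℝ (Fin 4)) M] [IsManifold (𝓡 4) ∞ M]
    (hglue : IsBoundaryGluing bX bW Ψ (𝓡 4) M) :
    ∃ (W₂ : Type) (_ : TopologicalSpace W₂) (_ : ChartedSpace (EuclideanHalfSpace 4) W₂)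
      (_ : IsManifold (𝓡∂ 4) ∞ W₂) (_ : CompactSpace W₂) (_ : T2Space W₂)
      (_ : SecondCountableTopology W₂)
      (b₂ : BoundaryData (𝓡∂ 4) W₂ (𝓡 3))
      (φ : (BoundaryManifold.boundaryData 3 X₁).carrier ≃ₘ⟮𝓡 3, 𝓡 3⟯ b₂.carrier),
      IsBoundaryGluing (BoundaryManifold.boundaryData 3 X₁) b₂ φ (𝓡 4) M := by
  obtain ⟨-, jA, jB, hjA, hjAo, -, -, -, -⟩ := hX
  obtain ⟨jX, jW, hjX, -, -, -⟩ := hglue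
  haveI : Nonempty (BoundaryManifold.boundaryData 3 X₁).carrier := hne.to_subtype
  obtain ⟨D⟩ := (BoundaryManifold.boundaryData 3 X₁).nonempty_openCollar
  have hC : ∀ x, (𝓡∂ 4).IsInteriorPoint x → x ∈ coresComplement q := fun x hx =>
    (mem_coresComplement q).2 fun i hi =>
      ((𝓡∂ 4).isInteriorPoint_iff_not_isBoundaryPoint x).1 hx ((q i).core_subset_boundary hi)
  exact ⟨_, inferInstance, inferInstance, inferInstance, inferInstance, inferInstance, inferInstance,
    _, _, isBoundaryGluing_superlevel D hC hjA hjAo hjX⟩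

/-- **Registered helper `helper_exists_complement_of_split` (sub-goal T2 of NF6
`stub_steinRealisation`, wave 2, lead c4): the complement piece of the positive sub-handlebody of
a sorted fibred model.**  From `ModelsOnFibred M g (P ++ N)` — `M = X(F; P ++ N) ∪_Ψ Base g` — one
gets the Lefschetz link `h̄` of the model, Baykur's `X₊ = X₁ = Base g ∪ (h̄ᵢ)_{i < |P|}` (compact,
with multi-attachment data `D₁` of the prefix sub-link, `helper_isMultiAttachment_split_append`),
a compact `4`-manifold with boundary `W₂`, boundary data `b₁`, `b₂` and a diffeomorphism
`φ : ∂X₁ ≅ ∂W₂` with `M = X₁ ∪_φ W₂` (`IsBoundaryGluing b₁ b₂ φ (𝓡 4) M`).  This is the topological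
content of "`M = W₁ ∪ W₂`, `W₁ = X₊`" in Baykur (2006), proof of Thm. 5.1; the identification of
`W₂` with the anti-Lefschetz handlebody `−X₋` and the Stein structures are NOT part of this helper.
[cite: Baykur2006, Thm. 5.1 (proof, pp. 13–14)] -/
theorem helper_exists_complement_of_split :
    ∀ (M : Type) [TopologicalSpace M] [T2Space M] [SecondCountableTopology M]
      [ChartedSpace (EuclideanSpace ℝ (Fin 4)) M] [IsManifold (𝓡 4) ∞ M]
      (g : ℕ) (P N : List ((Fin g ⊕ Fin g → ℤ) × Bool)), ModelsOnFibred M g (P ++ N) →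
      ∃ (h : Fin (P ++ N).length → HandleAttachingMap 3 2 (Base g))
        (X₁ : Type) (_ : TopologicalSpace X₁) (_ : T2Space X₁) (_ : SecondCountableTopology X₁)
        (_ : CompactSpace X₁) (_ : ChartedSpace (EuclideanHalfSpace 4) X₁) (_ : IsManifold (𝓡∂ 4) ∞ X₁)
        (_ : HandleAttachingMap.MultiAttachmentData
          (fun i : Fin P.length => h (Fin.cast List.length_append.symm (Fin.castAdd N.length i)))
          (𝓡∂ 4) X₁)
        (W₂ : Type) (_ : TopologicalSpace W₂) (_ : ChartedSpace (EuclideanHalfSpace 4) W₂)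
        (_ : IsManifold (𝓡∂ 4) ∞ W₂) (_ : CompactSpace W₂) (_ : T2Space W₂)
        (_ : SecondCountableTopology W₂)
        (b₁ : BoundaryData (𝓡∂ 4) X₁ (𝓡 3)) (b₂ : BoundaryData (𝓡∂ 4) W₂ (𝓡 3))
        (φ : b₁.carrier ≃ₘ⟮𝓡 3, 𝓡 3⟯ b₂.carrier),
        IsLefschetzLink g (P ++ N) h ∧ IsBoundaryGluing b₁ b₂ φ (𝓡 4) M := by
  intro M _ _ _ _ _ g P N hM
  obtain ⟨X, _, _, _, _, _, _, h, Dm, bX, Ψ, hlink, hglue, -⟩ := hM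
  obtain ⟨X₁, _, _, _, _, _, _, D₁, hd, hX', -⟩ :=
    helper_isMultiAttachment_split_append g P N h X Dm.isMultiAttachment
  haveI : CompactSpace M := hglue.compactSpace
  -- `∂X₁ ≠ ∅`: a boundary point of `X` (`∂X ≅ ∂Base g ≠ ∅`) is a boundary point of `X₁` off the
  -- cores or lies in a negative handle, whose attaching circle lies in `∂X₁`
  have hne : ((𝓡∂ 4).boundary X₁).Nonempty := by
    obtain ⟨-, jA', jB', hjA', hjA'o, -, hcov, -, -⟩ := hX'
    obtain ⟨y₀⟩ := nonempty_bBase_carrier g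
    have hy : bX.incl (Ψ.symm y₀) ∈ range jA' ∪ ⋃ j, range (jB' j) := by
      rw [hcov]; exact mem_univ _
    rcases hy with ⟨a, ha⟩ | hyB
    · refine ⟨a.1, (mem_boundary_opens_iff _ a).1
        ((mem_boundary_iff_of_isSmoothEmbedding hjA' hjA'o a).1 ?_)⟩
      rw [ha]
      exact bX.incl_mem_boundary _
    · obtain ⟨j, -⟩ := mem_iUnion.1 hyB
      obtain ⟨θ, hθ⟩ : (Metric.sphere (0 : EuclideanSpace ℝ (Fin 2)) 1).Nonempty :=
        NormedSpace.sphere_nonempty.2 zero_le_one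
      exact ⟨_, HandleAttachingMap.core_subset_boundary _
        ((HandleAttachingMap.range_attachingCircle
          (D₁.lift (h (Fin.cast List.length_append.symm (Fin.natAdd P.length j))) (hd j))).subset
          (mem_range_self (⟨θ, hθ⟩ : Metric.sphere (0 : EuclideanSpace ℝ (Fin 2)) 1)))⟩
  obtain ⟨W₂, _, _, _, _, _, _, b₂, φ, hW⟩ :=
    exists_complement_of_isMultiAttachment hne hX' bX (bBase g) Ψ hglue
  exact ⟨h, X₁, _, inferInstance, inferInstance, inferInstance, _, inferInstance, D₁, W₂, _, _,
    inferInstance, inferInstance, inferInstance, inferInstance, _, b₂, φ, hlink, hW⟩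

end Application

end Summit.SmoothPoincare4.SmoothPoincare4.Theorems.AcyclicBisectionExists.ModpBraidOrbits

end
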